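import Literature.Analysis.FluidPDE.BeltramiWavesCurl
import Literature.Analysis.FluidPDE.NSGalerkinFourier
import Literature.Analysis.FluidPDE.StatisticalSolutionEnergyEq
import Literature.Analysis.FunctionSpaces.TorusFourierModes

/-!
# Coefficient-space calculus of single real Fourier modes on `T³`

Helper file for stub S6 (`stub_order2Design`) of the line `recession-cone` of crux
`MomentParity.QuarticGate`. All bookkeeping of the explicit order-2 design is done on FOURIER
COEFFICIENT FAMILIES `c : (Fin 3 → ℤ) → ℂ³` over a symmetric finite frequency set `S`; the atoms
are sums of *linearly polarised single modes* `Pi.single k (a • v) + Pi.single (-k) (ā • v)`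
(`v` a complexified real vector, `a ∈ ℂ`), i.e. the fields `Re (e_k (2a) v)`. This file collects
the elementary evaluations: sums over `S` of functions of such families, the convection symbol
`Torus.convectionCoeff` and the curl symbol `IntermittentBeltrami.curlCoeff` on single modes,
conjugate symmetry / transversality, the link with `Torus.realTrigPoly {k}`, the sign and phase
averages (`Bool` signs, quarter-turn phases `I^m`, `m : Fin 4`), and the polarisation identity
for a bilinear map averaged over two independent signs.
-/

namespace Summit.AnomalousDissipation.AnomalousDissipation.Theorems.MomentParityQuarticGate

open MeasureTheory Filter Complex
open scoped InnerProductSpace ComplexConjugate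
open Literature.Analysis.FunctionSpaces Literature.Analysis.FluidPDE

set_option linter.dupNamespace false

/-! ## Sums over a frequency set of functions of a two-point family -/

section TwoPoint

variable {M : Type*} [AddCommMonoid M]

/-- A sum over `S ∋ k, k'` (`k ≠ k'`) of a function vanishing at `0`, evaluated on the family
`Pi.single k u + Pi.single k' u'`, has exactly two terms. [folklore] -/
theorem sum_apply_single_add_single {V : Type*} [AddCommMonoid V] {S : Finset (Fin 3 → ℤ)}
    {k k' : Fin 3 → ℤ} (hkk' : k ≠ k') (hk : k ∈ S) (hk' : k' ∈ S) (F : (Fin 3 → ℤ) → V → M)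
    (hF : ∀ κ, F κ 0 = 0) (u u' : V) :
    ∑ κ ∈ S, F κ ((Pi.single k u + Pi.single k' u' : (Fin 3 → ℤ) → V) κ) = F k u + F k' u' := by
  rw [Finset.sum_eq_add k k' hkk' (fun κ _ hκ => by
      simp only [Pi.add_apply, Pi.single_eq_of_ne hκ.1, Pi.single_eq_of_ne hκ.2, add_zero, hF])
    (fun h => (h hk).elim) (fun h => (h hk').elim)]
  simp only [Pi.add_apply, Pi.single_eq_same, Pi.single_eq_of_ne hkk', Pi.single_eq_of_ne hkk'.symm,
    add_zero, zero_add]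

/-- A sum over `S ∋ m` against a single vector family picks out one term. [folklore] -/
theorem sum_apply_single {V : Type*} [AddCommMonoid V] {S : Finset (Fin 3 → ℤ)} {m : Fin 3 → ℤ}
    (hm : m ∈ S) (F : (Fin 3 → ℤ) → V → M) (hF : ∀ κ, F κ 0 = 0) (w : V) :
    ∑ κ ∈ S, F κ ((Pi.single m w : (Fin 3 → ℤ) → V) κ) = F m w := by
  rw [Finset.sum_eq_single m (fun κ _ hκ => by rw [Pi.single_eq_of_ne hκ, hF]) (fun h => (h hm).elim),
    Pi.single_eq_same]

end TwoPoint

/-! ## Norm sums and pairings of two-point families in `EuclideanSpace ℂ (Fin 3)` -/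

section NormSums

/-- `∑_{κ∈S} ‖(δ_k u + δ_{k'} u') κ‖² = ‖u‖² + ‖u'‖²` (`k ≠ k'` in `S`). [folklore] -/
theorem sum_norm_sq_single_add_single {S : Finset (Fin 3 → ℤ)} {k k' : Fin 3 → ℤ} (hkk' : k ≠ k')
    (hk : k ∈ S) (hk' : k' ∈ S) (u u' : EuclideanSpace ℂ (Fin 3)) :
    ∑ κ ∈ S, ‖(Pi.single k u + Pi.single k' u' : (Fin 3 → ℤ) → EuclideanSpace ℂ (Fin 3)) κ‖ ^ 2 = ‖u‖ ^ 2 + ‖u'‖ ^ 2 :=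
  sum_apply_single_add_single hkk' hk hk' (fun _ z => ‖z‖ ^ 2) (fun _ => by simp) u u'

/-- `∑_{κ∈S} |κ|² ‖(δ_k u + δ_{k'} u') κ‖² = |k|² ‖u‖² + |k'|² ‖u'‖²` (`k ≠ k'` in `S`). [folklore] -/
theorem sum_freqNormSq_mul_norm_sq_single_add_single {S : Finset (Fin 3 → ℤ)} {k k' : Fin 3 → ℤ}
    (hkk' : k ≠ k') (hk : k ∈ S) (hk' : k' ∈ S) (u u' : EuclideanSpace ℂ (Fin 3)) :
    ∑ κ ∈ S, Torus.freqNormSq κ * ‖(Pi.single k u + Pi.single k' u' : (Fin 3 → ℤ) → EuclideanSpace ℂ (Fin 3)) κ‖ ^ 2 =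
      Torus.freqNormSq k * ‖u‖ ^ 2 + Torus.freqNormSq k' * ‖u'‖ ^ 2 :=
  sum_apply_single_add_single hkk' hk hk' (fun κ z => Torus.freqNormSq κ * ‖z‖ ^ 2)
    (fun _ => by simp) u u'

/-- `∑_{κ∈S} Re ⟪c κ, (δ_m w) κ⟫ = Re ⟪c m, w⟫` for `m ∈ S`. [folklore] -/
theorem sum_re_inner_single_right {S : Finset (Fin 3 → ℤ)} {m : Fin 3 → ℤ} (hm : m ∈ S)
    (c : (Fin 3 → ℤ) → EuclideanSpace ℂ (Fin 3)) (w : EuclideanSpace ℂ (Fin 3)) :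
    ∑ κ ∈ S, (inner ℂ (c κ) ((Pi.single m w : (Fin 3 → ℤ) → EuclideanSpace ℂ (Fin 3)) κ)).re = (inner ℂ (c m) w).re := by
  rw [Finset.sum_eq_single m (fun κ _ hκ => by rw [Pi.single_eq_of_ne hκ, inner_zero_right, zero_re])
    (fun h => (h hm).elim), Pi.single_eq_same]

/-- `∑_{κ∈S} Re ⟪(δ_m w) κ, c κ⟫ = Re ⟪w, c m⟫` for `m ∈ S`. [folklore] -/
theorem sum_re_inner_single_left {S : Finset (Fin 3 → ℤ)} {m : Fin 3 → ℤ} (hm : m ∈ S)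
    (c : (Fin 3 → ℤ) → EuclideanSpace ℂ (Fin 3)) (w : EuclideanSpace ℂ (Fin 3)) :
    ∑ κ ∈ S, (inner ℂ ((Pi.single m w : (Fin 3 → ℤ) → EuclideanSpace ℂ (Fin 3)) κ) (c κ)).re = (inner ℂ w (c m)).re := by
  rw [Finset.sum_eq_single m (fun κ _ hκ => by rw [Pi.single_eq_of_ne hκ, inner_zero_left, zero_re])
    (fun h => (h hm).elim), Pi.single_eq_same]

end NormSums

/-! ## The convection symbol on single modes -/

section Convection

/-- **The convection symbol of two single modes**: for `l, m ∈ S`,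
`convectionCoeff S (δ_l u) (δ_m w) κ = [l + m = κ] (2πi (u · m)) • w`. [folklore] -/
theorem convectionCoeff_single_single {S : Finset (Fin 3 → ℤ)} {l m : Fin 3 → ℤ} (hl : l ∈ S) (hm : m ∈ S)
    (u w : EuclideanSpace ℂ (Fin 3)) (κ : Fin 3 → ℤ) :
    Torus.convectionCoeff S (Pi.single l u) (Pi.single m w) κ =
      if l + m = κ then (2 * Real.pi * I * ∑ j, u j * (m j : ℂ)) • w else 0 := by
  rw [Torus.convectionCoeff_def]
  rw [Finset.sum_eq_single l (fun l' _ hl' => Finset.sum_eq_zero fun m' _ => by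
      simp [Pi.single_eq_of_ne hl']) (fun h => (h hl).elim)]
  rw [Finset.sum_eq_single m (fun m' _ hm' => by simp [Pi.single_eq_of_ne hm'])
    (fun h => (h hm).elim)]
  simp only [Pi.single_eq_same]

/-- The convection symbol of two single modes vanishes when the advecting amplitude is orthogonal
(bilinearly) to the advected frequency: `u · m = 0 ⟹ convectionCoeff S (δ_l u) (δ_m w) = 0`.
[folklore] -/
theorem convectionCoeff_single_single_eq_zero (S : Finset (Fin 3 → ℤ)) (l : Fin 3 → ℤ) {m : Fin 3 → ℤ}
    {u : EuclideanSpace ℂ (Fin 3)} (hum : ∑ j, u j * (m j : ℂ) = 0) (w : EuclideanSpace ℂ (Fin 3)) :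
    Torus.convectionCoeff S (Pi.single l u) (Pi.single m w) = 0 := by
  funext κ
  rw [Torus.convectionCoeff_def]
  refine Finset.sum_eq_zero fun l' _ => Finset.sum_eq_zero fun m' _ => ?_
  split_ifs with h
  · by_cases hl' : l' = l
    · subst hl'
      by_cases hm' : m' = m
      · subst hm'
        simp only [Pi.single_eq_same, hum, mul_zero, zero_smul]
      · simp [Pi.single_eq_of_ne hm']
    · simp [Pi.single_eq_of_ne hl']
  · rfl

end Convection


/-! ## The curl symbol -/

section Curl

/-- The curl symbol is diagonal: `curlCoeff c k` only depends on `c k`. [folklore] -/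
theorem curlCoeff_congr_apply {c c' : (Fin 3 → ℤ) → EuclideanSpace ℂ (Fin 3)} {k : Fin 3 → ℤ} (h : c k = c' k) :
    IntermittentBeltrami.curlCoeff c k = IntermittentBeltrami.curlCoeff c' k := by
  unfold IntermittentBeltrami.curlCoeff
  rw [h]

/-- The curl symbol vanishes where the family vanishes. [folklore] -/
theorem curlCoeff_apply_eq_zero {c : (Fin 3 → ℤ) → EuclideanSpace ℂ (Fin 3)} {k : Fin 3 → ℤ} (h : c k = 0) :
    IntermittentBeltrami.curlCoeff c k = 0 := by
  ext i
  rw [IntermittentBeltrami.curlCoeff_apply, h]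
  simp

/-- The curl symbol is additive. [folklore] -/
theorem curlCoeff_add (c c' : (Fin 3 → ℤ) → EuclideanSpace ℂ (Fin 3)) (k : Fin 3 → ℤ) :
    IntermittentBeltrami.curlCoeff (c + c') k =
      IntermittentBeltrami.curlCoeff c k + IntermittentBeltrami.curlCoeff c' k := by
  ext i
  simp only [IntermittentBeltrami.curlCoeff_apply, Pi.add_apply, WithLp.ofLp_add, map_add,
    PiLp.add_apply, mul_add]

/-- The curl symbol is `ℂ`-homogeneous. [folklore] -/
theorem curlCoeff_smul (a : ℂ) (c : (Fin 3 → ℤ) → EuclideanSpace ℂ (Fin 3)) (k : Fin 3 → ℤ) :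
    IntermittentBeltrami.curlCoeff (a • c) k = a • IntermittentBeltrami.curlCoeff c k := by
  ext i
  simp only [IntermittentBeltrami.curlCoeff_apply, Pi.smul_apply, WithLp.ofLp_smul, map_smul,
    PiLp.smul_apply, smul_eq_mul]
  ring

/-- The curl symbol is `ℝ`-homogeneous. [folklore] -/
theorem curlCoeff_real_smul (a : ℝ) (c : (Fin 3 → ℤ) → EuclideanSpace ℂ (Fin 3)) (k : Fin 3 → ℤ) :
    IntermittentBeltrami.curlCoeff (a • c) k = a • IntermittentBeltrami.curlCoeff c k := by
  rw [← Complex.coe_smul, ← Complex.coe_smul, ← curlCoeff_smul]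

/-- The curl symbol commutes with negation. [folklore] -/
theorem curlCoeff_neg (c : (Fin 3 → ℤ) → EuclideanSpace ℂ (Fin 3)) (k : Fin 3 → ℤ) :
    IntermittentBeltrami.curlCoeff (-c) k = -IntermittentBeltrami.curlCoeff c k := by
  rw [← neg_one_smul ℂ c, curlCoeff_smul, neg_one_smul]

/-- **Linearly polarised amplitudes are orthogonal to their own curl**: if `c k = b • v` with `v`
a complexified real vector, then `⟪a • v, curlCoeff c k⟫_ℂ = 2πi ā b (v · (k × v)) = 0`.
[folklore] -/
theorem inner_curlCoeff_eq_zero_of_parallel {c : (Fin 3 → ℤ) → EuclideanSpace ℂ (Fin 3)} {k : Fin 3 → ℤ} {v : EuclideanSpace ℝ (Fin 3)} {a b : ℂ}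
    (hck : c k = b • EuclideanSpace.complexify v) :
    inner ℂ (a • EuclideanSpace.complexify v) (IntermittentBeltrami.curlCoeff c k) = 0 := by
  obtain ⟨h0, h1, h2⟩ := IntermittentBeltrami.cross_apply_fin (fun j => ((k j : ℤ) : ℂ)) (WithLp.ofLp (c k))
  have hci : ∀ i, c k i = b * (v i : ℂ) := fun i => by rw [hck]; simp
  simp only [PiLp.inner_apply, RCLike.inner_apply, Fin.sum_univ_three,
    IntermittentBeltrami.curlCoeff_apply, h0, h1, h2]
  simp only [hci, PiLp.smul_apply, EuclideanSpace.complexify_apply, smul_eq_mul, map_mul, Complex.conj_ofReal]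
  ring

end Curl

/-! ## Signs, phases, and the two-sign polarisation identity -/

section Averages

/-- The two signs `±1` (indexed by `Bool`) sum to zero. [folklore] -/
theorem sum_bool_sign : ∑ s : Bool, (if s then (1 : ℝ) else -1) = 0 := by
  simp

/-- The two signs `±1` act on a vector with zero sum. [folklore] -/
theorem sum_bool_sign_smul {V : Type*} [AddCommGroup V] [Module ℝ V] (x : V) :
    ∑ s : Bool, (if s then (1 : ℝ) else -1) • x = 0 := by
  simp

/-- The square of a sign is one. [folklore] -/
theorem sign_mul_self (s : Bool) : (if s then (1 : ℝ) else -1) * (if s then (1 : ℝ) else -1) = 1 := by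
  cases s <;> simp

/-- **The quarter-turn phases sum to zero**: `∑_{m<4} i^m = 0`. [folklore] -/
theorem sum_I_pow_fin_four : ∑ m : Fin 4, Complex.I ^ (m : ℕ) = 0 := by
  simp only [Fin.sum_univ_four, Fin.val_zero, Fin.val_one, Fin.val_two, pow_zero, pow_one,
    show ((3 : Fin 4) : ℕ) = 3 from rfl]
  linear_combination (1 + Complex.I) * Complex.I_sq

/-- The conjugate quarter-turn phases sum to zero: `∑_{m<4} conj (i^m) = 0`. [folklore] -/
theorem sum_conj_I_pow_fin_four : ∑ m : Fin 4, conj (Complex.I ^ (m : ℕ)) = 0 := by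
  rw [← map_sum, sum_I_pow_fin_four, map_zero]

/-- The squared quarter-turn phases sum to zero: `∑_{m<4} i^m i^m = 0`. [folklore] -/
theorem sum_I_pow_mul_I_pow_fin_four : ∑ m : Fin 4, Complex.I ^ (m : ℕ) * Complex.I ^ (m : ℕ) = 0 := by
  simp only [Fin.sum_univ_four, Fin.val_zero, Fin.val_one, Fin.val_two, pow_zero, pow_one,
    show ((3 : Fin 4) : ℕ) = 3 from rfl]
  linear_combination (1 + Complex.I ^ 4) * Complex.I_sq

/-- The conjugate squared quarter-turn phases sum to zero. [folklore] -/
theorem sum_conj_I_pow_mul_conj_I_pow_fin_four :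
    ∑ m : Fin 4, conj (Complex.I ^ (m : ℕ)) * conj (Complex.I ^ (m : ℕ)) = 0 := by
  simp_rw [← map_mul]
  rw [← map_sum, sum_I_pow_mul_I_pow_fin_four, map_zero]

/-- `conj (i^m) i^m = 1`. [folklore] -/
theorem conj_I_pow_mul_I_pow (m : ℕ) : conj (Complex.I ^ m) * Complex.I ^ m = 1 := by
  rw [map_pow, Complex.conj_I, ← mul_pow, neg_mul, Complex.I_mul_I, neg_neg, one_pow]

/-- `i^m conj (i^m) = 1`. [folklore] -/
theorem I_pow_mul_conj_I_pow (m : ℕ) : Complex.I ^ m * conj (Complex.I ^ m) = 1 := by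
  rw [mul_comm, conj_I_pow_mul_I_pow]

/-- **Two-sign polarisation identity**: for a map `β` additive and odd in each argument,
averaging `β(x, x')` over `x = p ± q ± r`, `x' = p' ± q' ± r'` with the SAME two independent signs
kills all cross terms: `∑_{σ₁,σ₂} β(p + σ₁q + σ₂r, p' + σ₁q' + σ₂r') = 4 (β(p,p') + β(q,q') + β(r,r'))`.
[folklore] -/
theorem sum_sign_sign_biadditive {V W : Type*} [AddCommGroup V] [Module ℝ V] [AddCommGroup W]
    (β : V → V → W)
    (hadd₁ : ∀ x y z, β (x + y) z = β x z + β y z) (hadd₂ : ∀ x y z, β x (y + z) = β x y + β x z)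
    (hneg₁ : ∀ x z, β (-x) z = -β x z) (hneg₂ : ∀ x z, β x (-z) = -β x z)
    (p q r p' q' r' : V) :
    ∑ s₁ : Bool, ∑ s₂ : Bool,
      β (p + (if s₁ then (1 : ℝ) else -1) • q + (if s₂ then (1 : ℝ) else -1) • r)
        (p' + (if s₁ then (1 : ℝ) else -1) • q' + (if s₂ then (1 : ℝ) else -1) • r') =
      4 • (β p p' + β q q' + β r r') := by
  simp only [Fintype.sum_bool, Bool.false_eq_true, ↓reduceIte, one_smul, neg_one_smul, hadd₁, hadd₂,
    hneg₁, hneg₂]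
  abel

end Averages

/-! ## Linearly polarised two-point families: symmetry, transversality, and the real mode -/

section Polarised

/-- Values of the two-point family `δ_k (a v) + δ_{-k} (ā v)`: at every frequency it is a scalar
multiple of `v`. [folklore] -/
theorem single_add_single_apply (k κ : Fin 3 → ℤ) (a : ℂ) (x : EuclideanSpace ℂ (Fin 3)) :
    (Pi.single k (a • x) + Pi.single (-k) (conj a • x) : (Fin 3 → ℤ) → EuclideanSpace ℂ (Fin 3)) κ =
      ((Pi.single k a + Pi.single (-k) (conj a) : (Fin 3 → ℤ) → ℂ) κ) • x := by
  simp only [Pi.add_apply, Pi.single_apply, add_smul, ite_smul, zero_smul]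

/-- The scalar two-point family `δ_k a + δ_{-k} ā` is conjugate symmetric. [folklore] -/
theorem conj_single_add_single_apply (k κ : Fin 3 → ℤ) (a : ℂ) :
    (Pi.single k a + Pi.single (-k) (conj a) : (Fin 3 → ℤ) → ℂ) (-κ) =
      conj ((Pi.single k a + Pi.single (-k) (conj a) : (Fin 3 → ℤ) → ℂ) κ) := by
  simp only [Pi.add_apply, Pi.single_apply, map_add, apply_ite (starRingEnd ℂ), map_zero,
    Complex.conj_conj, neg_eq_iff_eq_neg, neg_neg]
  rw [add_comm]

/-- **Conjugate symmetry** of the linearly polarised two-point family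
`δ_k (a v) + δ_{-k} (ā v)` (`v` complexified real). [folklore] -/
theorem isConjSymm_single_add_single (k : Fin 3 → ℤ) (a : ℂ) (v : EuclideanSpace ℝ (Fin 3)) :
    Torus.IsConjSymm (Pi.single k (a • EuclideanSpace.complexify v) +
      Pi.single (-k) (conj a • EuclideanSpace.complexify v) : (Fin 3 → ℤ) → EuclideanSpace ℂ (Fin 3)) := by
  intro κ
  rw [single_add_single_apply, single_add_single_apply, EuclideanSpace.conjVec_smul,
    EuclideanSpace.conjVec_complexify, conj_single_add_single_apply]

/-- **Transversality** of the linearly polarised two-point family when `k · v = 0`. [folklore] -/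
theorem isTransversal_single_add_single (S : Finset (Fin 3 → ℤ)) {k : Fin 3 → ℤ} (a : ℂ) {v : EuclideanSpace ℝ (Fin 3)}
    (hkv : ∑ j, (k j : ℝ) * v j = 0) :
    Torus.IsTransversal S (Pi.single k (a • EuclideanSpace.complexify v) +
      Pi.single (-k) (conj a • EuclideanSpace.complexify v) : (Fin 3 → ℤ) → EuclideanSpace ℂ (Fin 3)) := by
  intro κ _
  have hkv' : ∑ j, (k j : ℂ) * (v j : ℂ) = 0 := by
    have := congrArg (fun r : ℝ => (r : ℂ)) hkv
    push_cast at this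
    exact this
  have hnkv : ∑ j, ((-k) j : ℂ) * (v j : ℂ) = 0 := by
    simp only [Pi.neg_apply, Int.cast_neg, neg_mul, Finset.sum_neg_distrib, hkv', neg_zero]
  have key : ∑ j, (κ j : ℂ) * (Pi.single k (a • EuclideanSpace.complexify v) +
      Pi.single (-k) (conj a • EuclideanSpace.complexify v) : (Fin 3 → ℤ) → EuclideanSpace ℂ (Fin 3)) κ j =
      ((Pi.single k a + Pi.single (-k) (conj a) : (Fin 3 → ℤ) → ℂ) κ) * ∑ j, (κ j : ℂ) * (v j : ℂ) := by
    rw [Finset.mul_sum]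
    refine Finset.sum_congr rfl fun j _ => ?_
    rw [single_add_single_apply, PiLp.smul_apply, EuclideanSpace.complexify_apply, smul_eq_mul]
    ring
  rw [key]
  rcases eq_or_ne κ k with rfl | h1
  · rw [hkv', mul_zero]
  rcases eq_or_ne κ (-k) with rfl | h2
  · rw [hnkv, mul_zero]
  · simp [h1, h2]

/-- **The linearly polarised two-point family is the single real mode**: on a frequency set
`S ∋ k, -k` with `k ≠ 0`,
`realTrigPoly S (δ_k (a/2 • v) + δ_{-k} (ā/2 • v)) = realTrigPoly {k} (a • v) = Re (e_k a v)`.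
[folklore] -/
theorem realTrigPoly_single_add_single {S : Finset (Fin 3 → ℤ)} {k : Fin 3 → ℤ} (hk : k ∈ S) (hnk : -k ∈ S)
    (hk0 : k ≠ 0) (a : ℂ) (v : EuclideanSpace ℝ (Fin 3)) :
    Torus.realTrigPoly S (Pi.single k ((a / 2) • EuclideanSpace.complexify v) +
        Pi.single (-k) (conj (a / 2) • EuclideanSpace.complexify v) : (Fin 3 → ℤ) → EuclideanSpace ℂ (Fin 3)) =
      Torus.realTrigPoly {k} (fun _ => a • EuclideanSpace.complexify v) := by
  have hkk : k ≠ -k := fun h => hk0 (by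
    have h2 : k + k = 0 := by nth_rewrite 2 [h]; exact add_neg_cancel k
    have : (2 : ℤ) • k = 0 := by rw [two_smul]; exact h2
    exact (smul_eq_zero.1 this).resolve_left two_ne_zero)
  funext x
  rw [Torus.realTrigPoly_apply, Torus.trigPoly_apply, Torus.realTrigPoly_singleton_apply,
    sum_apply_single_add_single hkk hk hnk (fun κ z => (UnitAddTorus.mFourier κ x : ℂ) • z)
      (fun _ => smul_zero _)]
  have hconj : (UnitAddTorus.mFourier (-k) x : ℂ) • (conj (a / 2) • EuclideanSpace.complexify v) =
      EuclideanSpace.conjVec ((UnitAddTorus.mFourier k x : ℂ) • ((a / 2) • EuclideanSpace.complexify v)) := by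
    rw [EuclideanSpace.conjVec_smul, EuclideanSpace.conjVec_smul, EuclideanSpace.conjVec_complexify,
      UnitAddTorus.mFourier_neg]
  rw [hconj, map_add, EuclideanSpace.realPart_conjVec, ← two_smul ℝ, ← map_smul]
  congr 1
  rw [smul_smul, smul_smul, ← Complex.coe_smul, smul_smul]
  congr 1
  push_cast
  ring

end Polarised

/-- **Registered sub-goal `modeCalculus_single_add_single` of stub S6** (summary of this file's
link between coefficient families and fields): the linearly polarised two-point coefficient
family IS the single real Fourier mode, for every symmetric pair `±k` of non-zero frequencies in
the frequency set. [folklore] -/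
theorem modeCalculus_single_add_single : ∀ (S : Finset (Fin 3 → ℤ)) (k : Fin 3 → ℤ) (a : ℂ) (v : EuclideanSpace ℝ (Fin 3)), k ∈ S → -k ∈ S → k ≠ 0 → Torus.realTrigPoly S (Pi.single k ((a / 2) • EuclideanSpace.complexify v) + Pi.single (-k) ((starRingEnd ℂ) (a / 2) • EuclideanSpace.complexify v)) = Torus.realTrigPoly {k} (fun _ => a • EuclideanSpace.complexify v) :=
  fun _ _ a v hk hnk hk0 => realTrigPoly_single_add_single hk hnk hk0 a v

end Summit.AnomalousDissipation.AnomalousDissipation.Theorems.MomentParityQuarticGate
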